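import Mathlib
import Summits.AnomalousDissipation.AnomalousDissipation.Theorems.DyadicWallCascadeDyadicRealisationFluxSignTools
import Summits.AnomalousDissipation.AnomalousDissipation.Theorems.DyadicWallCascadeDyadicRealisationFluxSignTools2
import HarnessLib

/-!
# The tested energy inequality at one dyadic scale, and its blow-down limit

Fourth tools file for `stub_fluxSign` (crux `DyadicRealisation`, line Sketch): for a bounded
smooth mirror-symmetric solution `(W, P)` of the clause-form steady Navier–Stokes system on `ℝ³`
and the product test function `χ(Y₀)χ(Y₁)θ(Y₂)` (`χ' = S'(·+R) − S'(·−R)`, `θ' = ρ(−·) − ρ`),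
the scaled local energy inequality gives
`2∫ χχρ W₂(λ·)(|W(λ·)|²/2 + P(λ·)) ≤ λ⁻¹A + 4C'(C'²/2 + C') ∫χ ∫θ` (`fluxSign_scale_ineq`:
split `Dφ·W`, bound the horizontal terms, fold the lower vertical edge onto the upper one by the
mirror symmetry); plus the limit / evaluation lemmas used downstream.  Ends with the registered
tools stub `stub_fluxSignTools4`.  All folklore calculus.
-/

open MeasureTheory Set Filter Topology Function

set_option linter.dupNamespace false

namespace Summit.AnomalousDissipation.AnomalousDissipation.Theorems

/-- The mirror reflection `X ↦ X − 2X₂e₂` is norm preserving on `ℝ³`. [folklore] -/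
theorem fluxSign_norm_reflect (X : EuclideanSpace ℝ (Fin 3)) :
    ‖X - (2 * X 2) • EuclideanSpace.single 2 (1 : ℝ)‖ = ‖X‖ := by
  have h0 : (X - (2 * X 2) • EuclideanSpace.single (2 : Fin 3) (1 : ℝ)) 0 = X 0 := by simp
  have h1 : (X - (2 * X 2) • EuclideanSpace.single (2 : Fin 3) (1 : ℝ)) 1 = X 1 := by simp
  have h2 : (X - (2 * X 2) • EuclideanSpace.single (2 : Fin 3) (1 : ℝ)) 2 = -(X 2) := by
    simp; ring
  rw [EuclideanSpace.norm_eq, EuclideanSpace.norm_eq, Fin.sum_univ_three, Fin.sum_univ_three,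
    h0, h1, h2, norm_neg]

/-- The mirror reflection commutes with dilations. [folklore] -/
theorem fluxSign_smul_reflect (lam : ℝ) (Y : EuclideanSpace ℝ (Fin 3)) :
    lam • (Y - (2 * Y 2) • EuclideanSpace.single 2 (1 : ℝ)) =
      lam • Y - (2 * (lam • Y) 2) • EuclideanSpace.single 2 (1 : ℝ) := by
  rw [smul_sub, smul_smul, PiLp.smul_apply, smul_eq_mul]
  congr 1
  rw [show lam * (2 * Y 2) = 2 * (lam * Y 2) by ring]

/-- Integrability on `ℝ³` of `a(Y₀) b(Y₁) c(Y₂) u(Y)` for continuous factors, the one-variable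
ones vanishing outside bounded sets. [folklore] -/
theorem fluxSign_integrable_prod3 (a b c : ℝ → ℝ) (u : EuclideanSpace ℝ (Fin 3) → ℝ)
    (ha : Continuous a) (hb : Continuous b) (hc : Continuous c) (hu : Continuous u)
    (ha' : ∃ r : ℝ, ∀ t, a t ≠ 0 → |t| ≤ r) (hb' : ∃ r : ℝ, ∀ t, b t ≠ 0 → |t| ≤ r)
    (hc' : ∃ r : ℝ, ∀ t, c t ≠ 0 → |t| ≤ r) :
    Integrable (fun Y : EuclideanSpace ℝ (Fin 3) => a (Y 0) * b (Y 1) * c (Y 2) * u Y) := by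
  obtain ⟨r0, hr0⟩ := ha'
  obtain ⟨r1, hr1⟩ := hb'
  obtain ⟨r2, hr2⟩ := hc'
  refine Continuous.integrable_of_hasCompactSupport ?_ ?_
  · exact (((ha.comp (PiLp.continuous_apply 2 _ 0)).mul (hb.comp (PiLp.continuous_apply 2 _ 1))).mul
      (hc.comp (PiLp.continuous_apply 2 _ 2))).mul hu
  · refine fluxSign_hasCompactSupport_of_box _ ⟨r0 + r1 + r2, fun Y hY => ?_⟩
    have h0 : a (Y 0) ≠ 0 := fun h => hY (by rw [h]; ring)
    have h1 : b (Y 1) ≠ 0 := fun h => hY (by rw [h]; ring)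
    have h2 : c (Y 2) ≠ 0 := fun h => hY (by rw [h]; ring)
    linarith [hr0 _ h0, hr1 _ h1, hr2 _ h2]

/-- `∫ a(Y₀) b(Y₁) c(Y₂) dY = (∫a)(∫b)(∫c)` on `ℝ³` (no integrability needed). [folklore] -/
theorem fluxSign_integral_prod3 (a b c : ℝ → ℝ) :
    ∫ Y : EuclideanSpace ℝ (Fin 3), a (Y 0) * b (Y 1) * c (Y 2) =
      (∫ t, a t) * (∫ t, b t) * ∫ t, c t := by
  have := fluxSign_integral_mul_split (fun q : ℝ × ℝ => a q.1 * b q.2) c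
  simp only at this
  rw [this, ← integral_prod_mul (μ := volume) (ν := volume) a b]
  rfl

/-- **The tested energy inequality at one scale.**  See the module docstring: for `(W, P)` bounded,
smooth, mirror-symmetric and solving the clause-form steady system, and profiles
`S' ≥ 0` (`∫S' = 1`), `χ ∈ C^∞_c` with `0 ≤ χ ≤ 1`, `χ' = S'(·+R) − S'(·−R)`, `θ ∈ C^∞_c` with
`0 ≤ θ ≤ 1`, `θ' = ρ(−·) − ρ`, there is `A` with
`2∫ χ(Y₀)χ(Y₁)ρ(Y₂) W₂(λY)(|W(λY)|²/2 + P(λY)) dY ≤ λ⁻¹A + 4C'(C'²/2 + C') ∫χ ∫θ` for all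
`λ > 0`. [folklore] -/
theorem fluxSign_scale_ineq
    (W : EuclideanSpace ℝ (Fin 3) → EuclideanSpace ℝ (Fin 3)) (P : EuclideanSpace ℝ (Fin 3) → ℝ)
    (C' : ℝ) (S1 χ ρ θ : ℝ → ℝ) (R : ℝ)
    (hW : ContDiff ℝ ((⊤ : ℕ∞) : WithTop ℕ∞) W) (hP : ContDiff ℝ ((⊤ : ℕ∞) : WithTop ℕ∞) P)
    (hdiv : ∀ X, ∑ i : Fin 3, (fderiv ℝ W X (EuclideanSpace.single i (1 : ℝ))) i = 0)
    (hNS : ∀ X, (fderiv ℝ W X) (W X) + gradient P X =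
      ∑ i : Fin 3, fderiv ℝ (fun Y => fderiv ℝ W Y (EuclideanSpace.single i (1 : ℝ))) X
        (EuclideanSpace.single i (1 : ℝ)))
    (hWb : ∀ X, ‖W X‖ ≤ C' ∧ |P X| ≤ C')
    (hmir : ∀ X : EuclideanSpace ℝ (Fin 3),
      W (X - (2 * X 2) • EuclideanSpace.single 2 (1 : ℝ)) =
          W X - (2 * (W X) 2) • EuclideanSpace.single 2 (1 : ℝ) ∧
        P (X - (2 * X 2) • EuclideanSpace.single 2 (1 : ℝ)) = P X)
    (hS1c : Continuous S1) (hS1cs : HasCompactSupport S1) (hS1nn : ∀ t, 0 ≤ S1 t)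
    (hS1i : ∫ t, S1 t = 1)
    (hχ : ContDiff ℝ ((⊤ : ℕ∞) : WithTop ℕ∞) χ) (hχcs : HasCompactSupport χ)
    (hχ01 : ∀ t, 0 ≤ χ t ∧ χ t ≤ 1) (hχd : ∀ t, deriv χ t = S1 (t + R) - S1 (t - R))
    (hρc : Continuous ρ) (hρcs : HasCompactSupport ρ)
    (hθ : ContDiff ℝ ((⊤ : ℕ∞) : WithTop ℕ∞) θ) (hθcs : HasCompactSupport θ)
    (hθ01 : ∀ s, 0 ≤ θ s ∧ θ s ≤ 1) (hθd : ∀ s, deriv θ s = ρ (-s) - ρ s) :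
    ∃ A : ℝ, ∀ lam : ℝ, 0 < lam →
      2 * ∫ Y : EuclideanSpace ℝ (Fin 3), χ (Y 0) * χ (Y 1) * ρ (Y 2) *
          ((W (lam • Y)) 2 * (‖W (lam • Y)‖ ^ 2 / 2 + P (lam • Y))) ≤
        lam⁻¹ * A + 4 * (C' * (C' ^ 2 / 2 + C')) * ((∫ t, χ t) * ∫ s, θ s) := by
  obtain ⟨hφs, hφd, hφcs'⟩ := fluxSign_testfun χ θ hχ hθ
  have hφcs := hφcs' hχcs hθcs
  have hφ0 : ∀ Y : EuclideanSpace ℝ (Fin 3), 0 ≤ χ (Y 0) * χ (Y 1) * θ (Y 2) := fun Y =>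
    mul_nonneg (mul_nonneg (hχ01 _).1 (hχ01 _).1) (hθ01 _).1
  obtain ⟨A, hA⟩ := fluxSign_energy_ineq W P _ C' hW hP hdiv hNS (fun X => (hWb X).1)
    (contDiff_infty.1 hφs 2) hφcs hφ0
  refine ⟨A, fun lam hlam => ?_⟩
  have key := hA lam hlam
  have hWc : Continuous W := hW.continuous
  have hPc : Continuous P := hP.continuous
  have hsc : Continuous fun Y : EuclideanSpace ℝ (Fin 3) => lam • Y := continuous_const_smul lam
  have hwc : Continuous fun Y : EuclideanSpace ℝ (Fin 3) => W (lam • Y) := hWc.comp hsc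
  have hGc : Continuous fun Y : EuclideanSpace ℝ (Fin 3) =>
      ‖W (lam • Y)‖ ^ 2 / 2 + P (lam • Y) :=
    ((hwc.norm.pow 2).div_const 2).add (hPc.comp hsc)
  have hwic : ∀ i : Fin 3, Continuous fun Y : EuclideanSpace ℝ (Fin 3) => (W (lam • Y)) i :=
    fun i => (PiLp.continuous_apply 2 _ i).comp hwc
  have hχc : Continuous χ := hχ.continuous
  have hθc : Continuous θ := hθ.continuous
  obtain ⟨rS, hrS⟩ := fluxSign_exists_abs_le_of_hasCompactSupport hS1cs
  have hχr := fluxSign_exists_abs_le_of_hasCompactSupport hχcs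
  have hθr := fluxSign_exists_abs_le_of_hasCompactSupport hθcs
  have hρr := fluxSign_exists_abs_le_of_hasCompactSupport hρcs
  have hρr' : ∃ r : ℝ, ∀ t, ρ (-t) ≠ 0 → |t| ≤ r := by
    obtain ⟨r, hr⟩ := hρr; exact ⟨r, fun t ht => by simpa using hr _ ht⟩
  have hshift : ∀ t, S1 (t - R) ≠ 0 ∨ S1 (t + R) ≠ 0 → |t| ≤ rS + |R| := by
    rintro t (h | h)
    · have h' := abs_add_le (t - R) R
      rw [sub_add_cancel] at h'
      linarith [hrS _ h]
    · have h' := abs_add_le (t + R) (-R)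
      rw [abs_neg, add_neg_cancel_right] at h'
      linarith [hrS _ h]
  have hSr : ∃ r : ℝ, ∀ t, S1 (t + R) - S1 (t - R) ≠ 0 → |t| ≤ r :=
    ⟨rS + |R|, fun t ht => hshift t (by
      by_contra h; push Not at h; exact ht (by rw [h.1, h.2, sub_zero]))⟩
  have hSpr : ∃ r : ℝ, ∀ t, S1 (t + R) + S1 (t - R) ≠ 0 → |t| ≤ r :=
    ⟨rS + |R|, fun t ht => hshift t (by
      by_contra h; push Not at h; exact ht (by rw [h.1, h.2, add_zero]))⟩
  have hSdc : Continuous fun t => S1 (t + R) - S1 (t - R) :=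
    (hS1c.comp (continuous_add_const R)).sub (hS1c.comp (continuous_sub_right R))
  have hSpc : Continuous fun t => S1 (t + R) + S1 (t - R) :=
    (hS1c.comp (continuous_add_const R)).add (hS1c.comp (continuous_sub_right R))
  -- the bound on the density `W_i (|W|²/2 + P)`
  have hC'0 : 0 ≤ C' := (norm_nonneg _).trans (hWb 0).1
  set Cw : ℝ := C' * (C' ^ 2 / 2 + C') with hCw
  have hdens : ∀ (i : Fin 3) (Y : EuclideanSpace ℝ (Fin 3)),
      |(W (lam • Y)) i * (‖W (lam • Y)‖ ^ 2 / 2 + P (lam • Y))| ≤ Cw := by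
    intro i Y
    rw [abs_mul, hCw]
    have h1 : |(W (lam • Y)) i| ≤ C' :=
      ((Real.norm_eq_abs _).symm.le.trans (PiLp.norm_apply_le (W (lam • Y)) i)).trans (hWb _).1
    have h2 : |‖W (lam • Y)‖ ^ 2 / 2 + P (lam • Y)| ≤ C' ^ 2 / 2 + C' := by
      refine (abs_add_le _ _).trans (add_le_add ?_ (hWb _).2)
      rw [abs_of_nonneg (by positivity)]
      have := pow_le_pow_left₀ (norm_nonneg _) (hWb (lam • Y)).1 2
      linarith
    exact mul_le_mul h1 h2 (abs_nonneg _) hC'0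
  -- expansion of the tested transport term
  have hexp : ∀ Y : EuclideanSpace ℝ (Fin 3),
      fderiv ℝ (fun Y : EuclideanSpace ℝ (Fin 3) => χ (Y 0) * χ (Y 1) * θ (Y 2)) Y (W (lam • Y)) *
          (‖W (lam • Y)‖ ^ 2 / 2 + P (lam • Y)) =
        (S1 (Y 0 + R) - S1 (Y 0 - R)) * χ (Y 1) * θ (Y 2) *
            ((W (lam • Y)) 0 * (‖W (lam • Y)‖ ^ 2 / 2 + P (lam • Y))) +
          χ (Y 0) * (S1 (Y 1 + R) - S1 (Y 1 - R)) * θ (Y 2) *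
            ((W (lam • Y)) 1 * (‖W (lam • Y)‖ ^ 2 / 2 + P (lam • Y))) +
          (χ (Y 0) * χ (Y 1) * ρ (-(Y 2)) *
              ((W (lam • Y)) 2 * (‖W (lam • Y)‖ ^ 2 / 2 + P (lam • Y))) -
            χ (Y 0) * χ (Y 1) * ρ (Y 2) *
              ((W (lam • Y)) 2 * (‖W (lam • Y)‖ ^ 2 / 2 + P (lam • Y)))) := by
    intro Y
    rw [hφd, hχd, hχd, hθd]
    ring
  -- integrability of the four pieces
  have huc : ∀ i : Fin 3, Continuous fun Y : EuclideanSpace ℝ (Fin 3) =>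
      (W (lam • Y)) i * (‖W (lam • Y)‖ ^ 2 / 2 + P (lam • Y)) := fun i => (hwic i).mul hGc
  have hI0 := fluxSign_integrable_prod3 (fun t => S1 (t + R) - S1 (t - R)) χ θ
    (fun Y => (W (lam • Y)) 0 * (‖W (lam • Y)‖ ^ 2 / 2 + P (lam • Y))) hSdc hχc hθc (huc 0)
    hSr hχr hθr
  have hI1 := fluxSign_integrable_prod3 χ (fun t => S1 (t + R) - S1 (t - R)) θ
    (fun Y => (W (lam • Y)) 1 * (‖W (lam • Y)‖ ^ 2 / 2 + P (lam • Y))) hχc hSdc hθc (huc 1)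
    hχr hSr hθr
  have hI2a := fluxSign_integrable_prod3 χ χ (fun s => ρ (-s))
    (fun Y => (W (lam • Y)) 2 * (‖W (lam • Y)‖ ^ 2 / 2 + P (lam • Y))) hχc hχc
    (hρc.comp continuous_neg) (huc 2) hχr hχr hρr'
  have hI2b := fluxSign_integrable_prod3 χ χ ρ
    (fun Y => (W (lam • Y)) 2 * (‖W (lam • Y)‖ ^ 2 / 2 + P (lam • Y))) hχc hχc hρc (huc 2)
    hχr hχr hρr
  simp_rw [hexp] at key
  rw [integral_add (hI0.fun_add hI1) (hI2a.sub' hI2b), integral_add hI0 hI1,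
    integral_sub hI2a hI2b] at key
  -- the reflected vertical edge
  have hrefl : ∫ Y : EuclideanSpace ℝ (Fin 3), χ (Y 0) * χ (Y 1) * ρ (-(Y 2)) *
      ((W (lam • Y)) 2 * (‖W (lam • Y)‖ ^ 2 / 2 + P (lam • Y))) =
      -∫ Y : EuclideanSpace ℝ (Fin 3), χ (Y 0) * χ (Y 1) * ρ (Y 2) *
        ((W (lam • Y)) 2 * (‖W (lam • Y)‖ ^ 2 / 2 + P (lam • Y))) := by
    rw [← integral_neg, ← fluxSign_integral_reflect]
    refine integral_congr_ae (Eventually.of_forall fun Y => ?_)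
    simp only
    rw [fluxSign_smul_reflect, (hmir _).1, (hmir _).2, fluxSign_norm_reflect]
    have c0 : (Y - (2 * Y 2) • EuclideanSpace.single (2 : Fin 3) (1 : ℝ)) 0 = Y 0 := by simp
    have c1 : (Y - (2 * Y 2) • EuclideanSpace.single (2 : Fin 3) (1 : ℝ)) 1 = Y 1 := by simp
    have c2 : (Y - (2 * Y 2) • EuclideanSpace.single (2 : Fin 3) (1 : ℝ)) 2 = -(Y 2) := by
      simp; ring
    have d2 : (W (lam • Y) - (2 * (W (lam • Y)) 2) • EuclideanSpace.single (2 : Fin 3) (1 : ℝ)) 2 =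
        -((W (lam • Y)) 2) := by
      simp; ring
    rw [c0, c1, c2, d2]
    ring
  rw [hrefl] at key
  -- the two horizontal terms
  have hS1sum : ∫ t, (S1 (t + R) + S1 (t - R)) = 2 := by
    have i1 : Integrable (fun t => S1 (t + R)) :=
      (hS1c.comp (continuous_add_const R)).integrable_of_hasCompactSupport
        (hS1cs.comp_homeomorph (Homeomorph.addRight R))
    have i2 : Integrable (fun t => S1 (t - R)) :=
      (hS1c.comp (continuous_sub_right R)).integrable_of_hasCompactSupport
        (hS1cs.comp_homeomorph (Homeomorph.subRight R))
    rw [integral_add i1 i2, integral_add_right_eq_self (μ := (volume : Measure ℝ)) S1 R,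
      integral_sub_right_eq_self (μ := (volume : Measure ℝ)) S1 R, hS1i]
    norm_num
  have hH0 : |∫ Y : EuclideanSpace ℝ (Fin 3), (S1 (Y 0 + R) - S1 (Y 0 - R)) * χ (Y 1) * θ (Y 2) *
      ((W (lam • Y)) 0 * (‖W (lam • Y)‖ ^ 2 / 2 + P (lam • Y)))| ≤
      2 * (∫ t, χ t) * (∫ s, θ s) * Cw := by
    have hg := fluxSign_integrable_prod3 (fun t => S1 (t + R) + S1 (t - R)) χ θ (fun _ => Cw)
      hSpc hχc hθc continuous_const hSpr hχr hθr
    refine (Real.norm_eq_abs _).symm.le.trans ((norm_integral_le_of_norm_le hg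
      (Eventually.of_forall fun Y => ?_)).trans (le_of_eq ?_))
    · rw [Real.norm_eq_abs, abs_mul, abs_mul, abs_mul, abs_of_nonneg (hχ01 _).1,
        abs_of_nonneg (hθ01 _).1]
      refine mul_le_mul (mul_le_mul_of_nonneg_right (mul_le_mul_of_nonneg_right
        ((abs_sub _ _).trans (by rw [abs_of_nonneg (hS1nn _), abs_of_nonneg (hS1nn _)]))
        (hχ01 _).1) (hθ01 _).1) (hdens 0 Y) (abs_nonneg _) ?_
      exact mul_nonneg (mul_nonneg (add_nonneg (hS1nn _) (hS1nn _)) (hχ01 _).1) (hθ01 _).1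
    · rw [integral_mul_const, fluxSign_integral_prod3 (fun t => S1 (t + R) + S1 (t - R)) χ θ,
        hS1sum]
  have hH1 : |∫ Y : EuclideanSpace ℝ (Fin 3), χ (Y 0) * (S1 (Y 1 + R) - S1 (Y 1 - R)) * θ (Y 2) *
      ((W (lam • Y)) 1 * (‖W (lam • Y)‖ ^ 2 / 2 + P (lam • Y)))| ≤
      2 * (∫ t, χ t) * (∫ s, θ s) * Cw := by
    have hg := fluxSign_integrable_prod3 χ (fun t => S1 (t + R) + S1 (t - R)) θ (fun _ => Cw)
      hχc hSpc hθc continuous_const hχr hSpr hθr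
    refine (Real.norm_eq_abs _).symm.le.trans ((norm_integral_le_of_norm_le hg
      (Eventually.of_forall fun Y => ?_)).trans (le_of_eq ?_))
    · rw [Real.norm_eq_abs, abs_mul, abs_mul, abs_mul, abs_of_nonneg (hχ01 _).1,
        abs_of_nonneg (hθ01 _).1]
      refine mul_le_mul (mul_le_mul_of_nonneg_right (mul_le_mul_of_nonneg_left
        ((abs_sub _ _).trans (by rw [abs_of_nonneg (hS1nn _), abs_of_nonneg (hS1nn _)]))
        (hχ01 _).1) (hθ01 _).1) (hdens 1 Y) (abs_nonneg _) ?_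
      exact mul_nonneg (mul_nonneg (hχ01 _).1 (add_nonneg (hS1nn _) (hS1nn _))) (hθ01 _).1
    · rw [integral_mul_const, fluxSign_integral_prod3 χ (fun t => S1 (t + R) + S1 (t - R)) θ,
        hS1sum]
      ring
  have := abs_le.1 hH0
  have := abs_le.1 hH1
  rw [hCw] at hH0 hH1
  nlinarith [abs_le.1 hH0, abs_le.1 hH1]

/-- **Passing a uniform scale bound to the blow-down limit.**  If `2∫ g uₘ ≤ 2⁻ᵐ A + B` for all
`m`, `g` is integrable and `uₘ → Φ` uniformly on `{g ≠ 0}`, then `2∫ g Φ ≤ B`. [folklore] -/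
theorem fluxSign_limit_le (g Φ : EuclideanSpace ℝ (Fin 3) → ℝ) (u : ℕ → EuclideanSpace ℝ (Fin 3) → ℝ)
    (A B : ℝ) (hg : Integrable g) (hgu : ∀ m, Integrable fun Y => g Y * u m Y)
    (hgΦ : Integrable fun Y => g Y * Φ Y)
    (hconv : ∀ ε : ℝ, 0 < ε → ∃ M : ℕ, ∀ m : ℕ, M ≤ m → ∀ Y, g Y ≠ 0 → |u m Y - Φ Y| ≤ ε)
    (hineq : ∀ m : ℕ, 2 * ∫ Y, g Y * u m Y ≤ ((2 : ℝ) ^ m)⁻¹ * A + B) :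
    2 * ∫ Y, g Y * Φ Y ≤ B := by
  refine le_of_forall_pos_le_add fun η hη => ?_
  set K : ℝ := ∫ Y, |g Y| with hK
  have hK0 : 0 ≤ K := integral_nonneg fun Y => abs_nonneg _
  have hpow : Tendsto (fun m : ℕ => ((2 : ℝ) ^ m)⁻¹ * A) atTop (𝓝 (0 * A)) := by
    refine Tendsto.mul_const A ?_
    simpa [Function.comp_def] using
      tendsto_inv_atTop_zero.comp (tendsto_pow_atTop_atTop_of_one_lt (one_lt_two : (1 : ℝ) < 2))
  rw [zero_mul] at hpow
  obtain ⟨M1, hM1⟩ := (Metric.tendsto_atTop.1 hpow) (η / 2) (by positivity)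
  obtain ⟨M2, hM2⟩ := hconv (η / (4 * (K + 1))) (by positivity)
  set m := max M1 M2 with hm
  have h1 : ((2 : ℝ) ^ m)⁻¹ * A ≤ η / 2 := by
    have := hM1 m (le_max_left _ _)
    rw [Real.dist_eq, sub_zero] at this
    exact (le_abs_self _).trans this.le
  -- compare the two integrals
  have hdiff : |(∫ Y, g Y * u m Y) - ∫ Y, g Y * Φ Y| ≤ η / (4 * (K + 1)) * K := by
    rw [← integral_sub (hgu m) hgΦ]
    have hb : Integrable fun Y => η / (4 * (K + 1)) * |g Y| := hg.abs.const_mul _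
    refine (Real.norm_eq_abs _).symm.le.trans ((norm_integral_le_of_norm_le hb
      (Eventually.of_forall fun Y => ?_)).trans (le_of_eq ?_))
    · rw [Real.norm_eq_abs, ← mul_sub, abs_mul, mul_comm]
      by_cases h0 : g Y = 0
      · rw [h0]; simp
      · exact mul_le_mul_of_nonneg_right (hM2 m (le_max_right _ _) Y h0) (abs_nonneg _)
    · rw [integral_const_mul]
  have h2 : η / (4 * (K + 1)) * K ≤ η / 4 := by
    rw [div_mul_eq_mul_div, div_le_div_iff₀ (by positivity) (by positivity)]
    nlinarith
  have h3 := abs_le.1 hdiff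
  linarith [hineq m, h3.1, h3.2]

/-- `∫ Σ_{j<2R} κ(t+R−j) dt = 2R ∫κ` (translation invariance). [folklore] -/
theorem fluxSign_integral_sum_translates (κ : ℝ → ℝ) (R : ℕ) (hκ : Integrable κ) :
    ∫ t, ∑ j ∈ Finset.range (2 * R), κ (t + (R : ℝ) - (j : ℝ)) = 2 * (R : ℝ) * ∫ t, κ t := by
  have hj : ∀ j : ℕ, Integrable fun t : ℝ => κ (t + (R : ℝ) - (j : ℝ)) := fun j => by
    simp_rw [add_sub_assoc]
    exact hκ.comp_add_right _
  rw [integral_finsetSum _ (fun j _ => hj j)]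
  have : ∀ j : ℕ, ∫ t, κ (t + (R : ℝ) - (j : ℝ)) = ∫ t, κ t := fun j => by
    simp_rw [add_sub_assoc]
    exact integral_add_right_eq_self (μ := (volume : Measure ℝ)) κ _
  simp_rw [this]
  rw [Finset.sum_const, Finset.card_range, nsmul_eq_mul]
  push_cast
  ring

/-- Uniform continuity of a continuous function on the ball of radius `10` of `ℝ³`, in `ε`–`δ`
form. [folklore] -/
theorem fluxSign_unif_cont (Φ : EuclideanSpace ℝ (Fin 3) → ℝ) (hΦ : Continuous Φ) (ε : ℝ)
    (hε : 0 < ε) :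
    ∃ δ : ℝ, 0 < δ ∧ ∀ Y Y' : EuclideanSpace ℝ (Fin 3), ‖Y‖ ≤ 10 → ‖Y'‖ ≤ 10 →
      ‖Y - Y'‖ ≤ δ → |Φ Y - Φ Y'| ≤ ε := by
  have hK : IsCompact (Metric.closedBall (0 : EuclideanSpace ℝ (Fin 3)) 10) :=
    isCompact_closedBall 0 10
  have hu := hK.uniformContinuousOn_of_continuous hΦ.continuousOn
  rw [Metric.uniformContinuousOn_iff_le] at hu
  obtain ⟨δ, hδ, h⟩ := hu ε hε
  refine ⟨δ, hδ, fun Y Y' hY hY' hd => ?_⟩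
  have := h Y (mem_closedBall_zero_iff.2 hY) Y' (mem_closedBall_zero_iff.2 hY')
    (by rwa [dist_eq_norm])
  rwa [Real.dist_eq] at this

/-- **Evaluation of the limiting lower bound**: for the cell profile `κ`, a vertical weight `ρ`
with `∫ρ = 1` and a continuous bi-periodic `h`,
`∫ κ(Y₀)κ(Y₁)ρ(Y₂)(h(Y₀,Y₁) − c) dY = ∫_{[0,1]²} h − c`. [folklore] -/
theorem fluxSign_lower_eval (κ ρ : ℝ → ℝ) (h : ℝ × ℝ → ℝ) (c : ℝ) (hκ : Continuous κ)
    (hκ0 : ∀ t, t ≤ 0 → κ t = 0) (hκ2 : ∀ t, 2 ≤ t → κ t = 0)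
    (hκ1 : ∀ t, 0 ≤ t → t ≤ 1 → κ t + κ (t + 1) = 1) (hh : Continuous h)
    (hper1 : ∀ q : ℝ × ℝ, h (q.1 + 1, q.2) = h q) (hper2 : ∀ q : ℝ × ℝ, h (q.1, q.2 + 1) = h q)
    (hρ : ∫ s, ρ s = 1) :
    ∫ Y : EuclideanSpace ℝ (Fin 3), κ (Y 0) * κ (Y 1) * ρ (Y 2) * (h (Y 0, Y 1) - c) =
      (∫ q in Set.Icc (0 : ℝ) 1 ×ˢ Set.Icc (0 : ℝ) 1, h q) - c := by
  have hre : (∫ Y : EuclideanSpace ℝ (Fin 3), κ (Y 0) * κ (Y 1) * ρ (Y 2) * (h (Y 0, Y 1) - c)) =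
      ∫ Y : EuclideanSpace ℝ (Fin 3), κ (Y 0) * κ (Y 1) * (h (Y 0, Y 1) - c) * ρ (Y 2) :=
    integral_congr_ae (Eventually.of_forall fun Y => by simp only; ring)
  have hsplit := fluxSign_integral_mul_split (fun q : ℝ × ℝ => κ q.1 * κ q.2 * (h q - c)) ρ
  simp only at hsplit
  rw [hre, hsplit, hρ, mul_one,
    fluxSign_cell_average_two κ (fun q => h q - c) hκ (hh.sub continuous_const) hκ0 hκ2 hκ1
      (fun q => by rw [hper1]) (fun q => by rw [hper2])]
  have hS : IsCompact (Set.Icc (0 : ℝ) 1 ×ˢ Set.Icc (0 : ℝ) 1) := isCompact_Icc.prod isCompact_Icc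
  rw [integral_sub (hh.continuousOn.integrableOn_compact hS)
    (continuous_const.continuousOn.integrableOn_compact hS), setIntegral_const]
  have hvol : (volume : Measure (ℝ × ℝ)).real (Set.Icc (0 : ℝ) 1 ×ˢ Set.Icc (0 : ℝ) 1) = 1 := by
    simp only [Measure.real]
    rw [Measure.volume_eq_prod, Measure.prod_prod, Real.volume_Icc]
    simp
  rw [hvol, one_smul]

/-- Registered tools stub of `stub_fluxSign` (line Sketch of crux `DyadicRealisation`): the
conjunction of the lemmas of this file. [folklore] -/
theorem stub_fluxSignTools4 :
    (∀ X : EuclideanSpace ℝ (Fin 3), ‖X - (2 * X 2) • EuclideanSpace.single 2 (1 : ℝ)‖ = ‖X‖) ∧ (∀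
    (lam : ℝ) (Y : EuclideanSpace ℝ (Fin 3)), lam • (Y - (2 * Y 2) • EuclideanSpace.single 2 (1 :
    ℝ)) = lam • Y - (2 * (lam • Y) 2) • EuclideanSpace.single 2 (1 : ℝ)) ∧ (∀ (a b c : ℝ → ℝ) (u :
    EuclideanSpace ℝ (Fin 3) → ℝ), Continuous a → Continuous b → Continuous c → Continuous u → (∃ r
    : ℝ, ∀ t, a t ≠ 0 → |t| ≤ r) → (∃ r : ℝ, ∀ t, b t ≠ 0 → |t| ≤ r) → (∃ r : ℝ, ∀ t, c t ≠ 0 → |t|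
    ≤ r) → MeasureTheory.Integrable (fun Y : EuclideanSpace ℝ (Fin 3) => a (Y 0) * b (Y 1) * c (Y 2)
    * u Y)) ∧ (∀ (a b c : ℝ → ℝ), ∫ Y : EuclideanSpace ℝ (Fin 3), a (Y 0) * b (Y 1) * c (Y 2) = (∫
    t, a t) * (∫ t, b t) * ∫ t, c t) ∧ (∀ (W : EuclideanSpace ℝ (Fin 3) → EuclideanSpace ℝ (Fin 3))
    (P : EuclideanSpace ℝ (Fin 3) → ℝ) (C' : ℝ) (S1 χ ρ θ : ℝ → ℝ) (R : ℝ), ContDiff ℝ ((⊤ : ℕ∞) :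
    WithTop ℕ∞) W → ContDiff ℝ ((⊤ : ℕ∞) : WithTop ℕ∞) P → (∀ X : EuclideanSpace ℝ (Fin 3), ∑ i :
    Fin 3, (fderiv ℝ W X (EuclideanSpace.single i (1 : ℝ))) i = 0) → (∀ X : EuclideanSpace ℝ (Fin
    3), (fderiv ℝ W X) (W X) + gradient P X = ∑ i : Fin 3, fderiv ℝ (fun Y => fderiv ℝ W Y
    (EuclideanSpace.single i (1 : ℝ))) X (EuclideanSpace.single i (1 : ℝ))) → (∀ X : EuclideanSpace
    ℝ (Fin 3), ‖W X‖ ≤ C' ∧ |P X| ≤ C') → (∀ X : EuclideanSpace ℝ (Fin 3), W (X - (2 * X 2) •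
    EuclideanSpace.single 2 (1 : ℝ)) = W X - (2 * (W X) 2) • EuclideanSpace.single 2 (1 : ℝ) ∧ P (X
    - (2 * X 2) • EuclideanSpace.single 2 (1 : ℝ)) = P X) → Continuous S1 → HasCompactSupport S1 →
    (∀ t, 0 ≤ S1 t) → (∫ t, S1 t = 1) → ContDiff ℝ ((⊤ : ℕ∞) : WithTop ℕ∞) χ → HasCompactSupport χ →
    (∀ t, 0 ≤ χ t ∧ χ t ≤ 1) → (∀ t, deriv χ t = S1 (t + R) - S1 (t - R)) → Continuous ρ →
    HasCompactSupport ρ → ContDiff ℝ ((⊤ : ℕ∞) : WithTop ℕ∞) θ → HasCompactSupport θ → (∀ s, 0 ≤ θ s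
    ∧ θ s ≤ 1) → (∀ s, deriv θ s = ρ (-s) - ρ s) → ∃ A : ℝ, ∀ lam : ℝ, 0 < lam → 2 * ∫ Y :
    EuclideanSpace ℝ (Fin 3), χ (Y 0) * χ (Y 1) * ρ (Y 2) * ((W (lam • Y)) 2 * (‖W (lam • Y)‖ ^ 2 /
    2 + P (lam • Y))) ≤ lam⁻¹ * A + 4 * (C' * (C' ^ 2 / 2 + C')) * ((∫ t, χ t) * ∫ s, θ s)) ∧ (∀ (g
    Φ : EuclideanSpace ℝ (Fin 3) → ℝ) (u : ℕ → EuclideanSpace ℝ (Fin 3) → ℝ) (A B : ℝ),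
    MeasureTheory.Integrable g → (∀ m, MeasureTheory.Integrable fun Y => g Y * u m Y) →
    (MeasureTheory.Integrable fun Y => g Y * Φ Y) → (∀ ε : ℝ, 0 < ε → ∃ M : ℕ, ∀ m : ℕ, M ≤ m → ∀ Y,
    g Y ≠ 0 → |u m Y - Φ Y| ≤ ε) → (∀ m : ℕ, 2 * ∫ Y, g Y * u m Y ≤ ((2 : ℝ) ^ m)⁻¹ * A + B) → 2 * ∫
    Y, g Y * Φ Y ≤ B) ∧ (∀ (κ : ℝ → ℝ) (R : ℕ), MeasureTheory.Integrable κ → ∫ t, ∑ j ∈ Finset.range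
    (2 * R), κ (t + (R : ℝ) - (j : ℝ)) = 2 * (R : ℝ) * ∫ t, κ t) ∧ (∀ (Φ : EuclideanSpace ℝ (Fin 3)
    → ℝ), Continuous Φ → ∀ ε : ℝ, 0 < ε → ∃ δ : ℝ, 0 < δ ∧ ∀ Y Y' : EuclideanSpace ℝ (Fin 3), ‖Y‖ ≤
    10 → ‖Y'‖ ≤ 10 → ‖Y - Y'‖ ≤ δ → |Φ Y - Φ Y'| ≤ ε) ∧ (∀ (κ ρ : ℝ → ℝ) (h : ℝ × ℝ → ℝ) (c : ℝ),
    Continuous κ → (∀ t, t ≤ 0 → κ t = 0) → (∀ t, 2 ≤ t → κ t = 0) → (∀ t, 0 ≤ t → t ≤ 1 → κ t + κ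
    (t + 1) = 1) → Continuous h → (∀ q : ℝ × ℝ, h (q.1 + 1, q.2) = h q) → (∀ q : ℝ × ℝ, h (q.1, q.2
    + 1) = h q) → (∫ s, ρ s = 1) → ∫ Y : EuclideanSpace ℝ (Fin 3), κ (Y 0) * κ (Y 1) * ρ (Y 2) * (h
    (Y 0, Y 1) - c) = (∫ q in Set.Icc (0 : ℝ) 1 ×ˢ Set.Icc (0 : ℝ) 1, h q) - c) :=
  ⟨fluxSign_norm_reflect, fluxSign_smul_reflect, fluxSign_integrable_prod3, fluxSign_integral_prod3,
    fluxSign_scale_ineq, fluxSign_limit_le, fluxSign_integral_sum_translates, fluxSign_unif_cont,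
    fluxSign_lower_eval⟩

end Summit.AnomalousDissipation.AnomalousDissipation.Theorems
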